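import Literature.MathematicalPhysics.QuantumLattice.FermionBoxProductMarginals
import Literature.MathematicalPhysics.QuantumLattice.HubbardTorusMarkovRectWindow
import HarnessLib

/-!
# Box-periodic data on the square torus: boxes `[0,a)×[0,b) + z(v)` and their seam gates as legs into
# `(ℤ/Lℤ)²`, disjointness, covering, and covariance under box translations

Topic `Literature/MathematicalPhysics/QuantumLattice` (namespace = path; family `hubbard`). Geometry layer of the kernel
reader for certificate **C3** (seam-dressed cluster product trial states) of the `T > 0` Hubbard programme
(`HubbardDressedClusterEnergyFunctional.lean` defines the per-box functional; the sequels prove the pressure floor).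
A box `[0,a) × [0,b) ⊆ ℤ²` (`rectWindow a b`), the box lattice `z(w) = (w₁ a, w₂ b)` (`latticeVec`), and the square
torus `FermionTorus 2 L` with `L = K_x a = K_y b`; the site map `x ↦ x mod L` (`torusPt`). We record:

* §1 `latticeVec`, `boxOf y = (⌊y₀/a⌋, ⌊y₁/b⌋)` with `y − z(boxOf y) ∈ [0,a)×[0,b)` and uniqueness, the bounded
  gate range `gateRange a b = [−a, 2a) × [−b, 2b)`; the (decidable) SEPARATION hypothesis used below reads «two gate
  sites congruent modulo the box lattice are the same site of the same gate» — all box-lattice translates of the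
  reference gates are pairwise disjoint;
* §2 `torusPt L x = x mod L` and its kernel (`torusPt_eq_iff`: coordinatewise divisibility by `L`);
* §3 the legs: `boxLeg … v : PolySite (rectWindow a b) ↪ FermionTorus 2 L`, `y ↦ (y + z(v)) mod L`, for a box index
  `v ∈ Fin K_x × Fin K_y`, and `gateLeg … (g, v) : PolySite (G g) ↪ FermionTorus 2 L` likewise; pairwise DISJOINT
  images (`disjoint_boxLeg`, `disjoint_gateLegT` — the latter from the separation hypothesis), and the boxes COVER the torus
  (`boxSiteEquiv : PolySite (rectWindow a b) × (Fin K_x × Fin K_y) ≃ FermionTorus 2 L`, `sum_torusSite_eq_sum_boxes`);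
* §4 translations: `relabel (Orb.translate c) ∘ Γ_ψ = Γ_{ψ + c}` for legs differing by a torus translation
  (`relabel_translate_fermionEmbed_of_shift`, from `algHom_ext_car`), `proj (z(v + w)) = proj z(v) + proj z(w)` on
  `Fin K_x × Fin K_y`, hence `T_{z(w)} Γ_{box v} = Γ_{box (v+w)}` and the same for gates.

Everything is PROVED; the definitions are explicit coordinate maps; no named fact.

## Tree / Mathlib search

REUSED: `rectWindow`, `mem_rectWindow_iff` (`HubbardTorusMarkovRectWindow`); `shiftSet`, `mem_shiftSet`; `Torus.proj`,
`FermionTorus.ofTorusSite/toTorusSite`, `Orb.translate`, `Orb.translate_orb`, `relabel_annihilation`, `relabel_creation`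
(`FockRelabel`); `fermionEmbed_annihilation/creation`, `algHom_ext_car`; `card_polySite`; Mathlib
`ZMod.intCast_eq_intCast_iff_dvd_sub`, `Int.eq_zero_of_abs_lt_dvd`, `Fintype.bijective_iff_injective_and_card`.

## References

* S. Friedli, Y. Velenik, *Statistical Mechanics of Lattice Systems* (2017), §3.1 (tori, translations, boxes).
  [cite: FriedliVelenik2017, §3.1]
* H. Araki, H. Moriya, Rev. Math. Phys. 15 (2003) 93, §4.1 Def. 4.3 (translation covariance of local algebras).
  [cite: ArakiMoriya2003, §4.1 Def. 4.3]
-/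

noncomputable section

namespace Literature.MathematicalPhysics.QuantumLattice

open Matrix Finset HubbardWave0 Literature.Probability.LatticeModels AndersonCluster ThermodynamicLimit
open scoped ComplexOrder BigOperators

namespace SeamDressed

/-! ### §1. The box lattice of `ℤ²` -/

section Lattice

variable (a b : ℕ)

/-- **The box-lattice vector** `z(w) = (w₁ a, w₂ b) ∈ ℤ²` of the offset `w ∈ ℤ²`. [cite: FriedliVelenik2017, §3.1] -/
def latticeVec (w : ℤ × ℤ) : Site 2 := ![w.1 * a, w.2 * b]

/-- Components of the box-lattice vector. [cite: FriedliVelenik2017, §3.1] -/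
@[simp] theorem latticeVec_zero (w : ℤ × ℤ) : latticeVec a b w 0 = w.1 * a := rfl

/-- Components of the box-lattice vector. [cite: FriedliVelenik2017, §3.1] -/
@[simp] theorem latticeVec_one (w : ℤ × ℤ) : latticeVec a b w 1 = w.2 * b := rfl

/-- `z` is additive. [cite: FriedliVelenik2017, §3.1] -/
theorem latticeVec_add (w w' : ℤ × ℤ) : latticeVec a b (w + w') = latticeVec a b w + latticeVec a b w' := by
  funext i
  fin_cases i <;> simp [latticeVec, add_mul]

/-- `z(−w) = −z(w)`. [cite: FriedliVelenik2017, §3.1] -/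
theorem latticeVec_neg (w : ℤ × ℤ) : latticeVec a b (-w) = -latticeVec a b w := by
  funext i
  fin_cases i <;> simp [latticeVec]

/-- **The box offset of a site**: `boxOf y = (⌊y₀/a⌋, ⌊y₁/b⌋)`. [cite: FriedliVelenik2017, §3.1] -/
def boxOf (y : Site 2) : ℤ × ℤ := (y 0 / a, y 1 / b)

/-- **A site minus its box-lattice vector lies in the reference box** (`a, b ≥ 1`). [cite: FriedliVelenik2017, §3.1] -/
theorem sub_latticeVec_boxOf_mem_rectWindow [NeZero a] [NeZero b] (y : Site 2) :
    y - latticeVec a b (boxOf a b y) ∈ rectWindow a b := by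
  have ha : (0 : ℤ) < a := by exact_mod_cast Nat.pos_of_ne_zero (NeZero.ne a)
  have hb : (0 : ℤ) < b := by exact_mod_cast Nat.pos_of_ne_zero (NeZero.ne b)
  rw [mem_rectWindow_iff]
  simp only [Pi.sub_apply, latticeVec_zero, latticeVec_one, boxOf]
  refine ⟨⟨?_, ?_⟩, ?_, ?_⟩
  · have := Int.emod_nonneg (y 0) ha.ne'; rw [Int.emod_def] at this; linarith
  · have := Int.emod_lt_of_pos (y 0) ha; rw [Int.emod_def] at this; linarith
  · have := Int.emod_nonneg (y 1) hb.ne'; rw [Int.emod_def] at this; linarith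
  · have := Int.emod_lt_of_pos (y 1) hb; rw [Int.emod_def] at this; linarith

/-- **Uniqueness of the box offset**: if `y − z(w) ∈ [0,a)×[0,b)` then `w = boxOf y`. [cite: FriedliVelenik2017, §3.1] -/
theorem boxOf_eq_of_sub_latticeVec_mem {y : Site 2} {w : ℤ × ℤ} (h : y - latticeVec a b w ∈ rectWindow a b) :
    boxOf a b y = w := by
  rw [mem_rectWindow_iff] at h
  simp only [Pi.sub_apply, latticeVec_zero, latticeVec_one] at h
  obtain ⟨⟨h0, h0'⟩, h1, h1'⟩ := h
  have ha : (0 : ℤ) < a := by linarith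
  have hb : (0 : ℤ) < b := by linarith
  refine Prod.ext ?_ ?_
  · show y 0 / a = w.1
    have e : y 0 = (y 0 - w.1 * a) + w.1 * a := by ring
    rw [e, Int.add_mul_ediv_right _ _ ha.ne', Int.ediv_eq_zero_of_lt h0 h0', zero_add]
  · show y 1 / b = w.2
    have e : y 1 = (y 1 - w.2 * b) + w.2 * b := by ring
    rw [e, Int.add_mul_ediv_right _ _ hb.ne', Int.ediv_eq_zero_of_lt h1 h1', zero_add]

/-- `boxOf (y + z(w)) = boxOf y + w`. [cite: FriedliVelenik2017, §3.1] -/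
theorem boxOf_add_latticeVec [NeZero a] [NeZero b] (y : Site 2) (w : ℤ × ℤ) :
    boxOf a b (y + latticeVec a b w) = boxOf a b y + w := by
  apply boxOf_eq_of_sub_latticeVec_mem
  have e : y + latticeVec a b w - latticeVec a b (boxOf a b y + w) = y - latticeVec a b (boxOf a b y) := by
    rw [latticeVec_add]; abel
  rw [e]
  exact sub_latticeVec_boxOf_mem_rectWindow a b y

/-- A site of the reference box has offset `0`. [cite: FriedliVelenik2017, §3.1] -/
theorem boxOf_eq_zero_of_mem {y : Site 2} (hy : y ∈ rectWindow a b) : boxOf a b y = 0 := by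
  refine boxOf_eq_of_sub_latticeVec_mem a b ?_
  have h0 : latticeVec a b (0 : ℤ × ℤ) = 0 := by
    funext i
    fin_cases i <;> simp [latticeVec]
  rwa [h0, sub_zero]

/-- **The bounded gate range** `[−a, 2a) × [−b, 2b)`: the reference gates of a seam-dressed cluster state sit near the
reference box. [cite: FriedliVelenik2017, §3.1] -/
def gateRange : Finset (Site 2) := shiftSet (-latticeVec a b (1, 1)) (rectWindow (3 * a) (3 * b))

/-- Coordinates of sites of the gate range differ by less than `3a` resp. `3b`. [cite: FriedliVelenik2017, §3.1] -/
theorem abs_sub_lt_of_mem_gateRange {y y' : Site 2} (hy : y ∈ gateRange a b) (hy' : y' ∈ gateRange a b) :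
    |y 0 - y' 0| < 3 * a ∧ |y 1 - y' 1| < 3 * b := by
  rw [gateRange, mem_shiftSet, mem_rectWindow_iff] at hy hy'
  have e0 : ∀ z : Site 2, (z - -latticeVec a b (1, 1)) 0 = z 0 + a := fun z => by
    simp [latticeVec]
  have e1 : ∀ z : Site 2, (z - -latticeVec a b (1, 1)) 1 = z 1 + b := fun z => by
    simp [latticeVec]
  rw [e0, e1] at hy hy'
  push_cast at hy hy'
  obtain ⟨⟨h1, h2⟩, h3, h4⟩ := hy
  obtain ⟨⟨h5, h6⟩, h7, h8⟩ := hy'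
  constructor <;> rw [abs_sub_lt_iff] <;> constructor <;> linarith

end Lattice

/-! ### §2. Sites of `ℤ²` in the torus -/

section TorusPt

variable (L : ℕ)

/-- `proj` is additive (re-derived locally to keep the import closure small). [cite: FriedliVelenik2017, §3.1] -/
theorem proj_add (x y : Site 2) : Torus.proj L (x + y) = Torus.proj L x + Torus.proj L y := by
  funext i
  change (((x + y) i : ℤ) : ZMod L) = ((x i : ℤ) : ZMod L) + ((y i : ℤ) : ZMod L)
  rw [Pi.add_apply, Int.cast_add]

variable [NeZero L]

/-- **The torus site `x mod L`** of `x ∈ ℤ²` (in the fermionic torus `FermionTorus 2 L`). [cite: FriedliVelenik2017, §3.1] -/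
def torusPt (x : Site 2) : FermionTorus 2 L := FermionTorus.ofTorusSite (Torus.proj L x)

/-- `toTorusSite (x mod L) = proj x`. [cite: FriedliVelenik2017, §3.1] -/
@[simp] theorem toTorusSite_torusPt (x : Site 2) : FermionTorus.toTorusSite (torusPt L x) = Torus.proj L x := by
  rw [torusPt, FermionTorus.toTorusSite_ofTorusSite]

/-- **Kernel of `x ↦ x mod L`**: `x mod L = y mod L ↔ L ∣ xᵢ − yᵢ` for both coordinates. [cite: FriedliVelenik2017, §3.1] -/
theorem torusPt_eq_iff {x y : Site 2} : torusPt L x = torusPt L y ↔ ∀ i, (L : ℤ) ∣ x i - y i := by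
  constructor
  · intro h i
    have h' : Torus.proj L x i = Torus.proj L y i := by
      have := congrArg FermionTorus.toTorusSite h
      rw [toTorusSite_torusPt, toTorusSite_torusPt] at this
      exact congrFun this i
    change ((x i : ℤ) : ZMod L) = ((y i : ℤ) : ZMod L) at h'
    exact (ZMod.intCast_eq_intCast_iff_dvd_sub (y i) (x i) L).1 h'.symm
  · intro h
    have h' : Torus.proj L x = Torus.proj L y := by
      funext i
      change ((x i : ℤ) : ZMod L) = ((y i : ℤ) : ZMod L)
      exact ((ZMod.intCast_eq_intCast_iff_dvd_sub (y i) (x i) L).2 (h i)).symm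
    rw [torusPt, torusPt, h']

/-- Adding a vector with coordinates divisible by `L` does not move the torus site. [cite: FriedliVelenik2017, §3.1] -/
theorem torusPt_add_of_dvd {x c : Site 2} (h : ∀ i, (L : ℤ) ∣ c i) : torusPt L (x + c) = torusPt L x :=
  (torusPt_eq_iff L).2 fun i => by simpa using h i

/-- Sites closer than `L` in every coordinate with the same torus site coincide. [cite: FriedliVelenik2017, §3.1] -/
theorem eq_of_torusPt_eq {x y : Site 2} (h : torusPt L x = torusPt L y) (hlt : ∀ i, |x i - y i| < L) : x = y := by
  funext i
  exact sub_eq_zero.1 (Int.eq_zero_of_abs_lt_dvd ((torusPt_eq_iff L).1 h i) (hlt i))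

end TorusPt

/-! ### §3. Boxes and gates as legs into the torus -/

section Legs

variable (a b : ℕ) [NeZero a] [NeZero b] (L : ℕ) [NeZero L] {Kx Ky : ℕ}
  (hLx : (L : ℤ) = Kx * a) (hLy : (L : ℤ) = Ky * b)

/-- **The lattice vector of a box index** `v ∈ Fin K_x × Fin K_y`: `z(v) = (v₁ a, v₂ b)`. [cite: FriedliVelenik2017, §3.1] -/
def boxVec (v : Fin Kx × Fin Ky) : Site 2 := latticeVec a b ((v.1 : ℤ), (v.2 : ℤ))

omit [NeZero a] [NeZero b] in
/-- Components of `boxVec`. [cite: FriedliVelenik2017, §3.1] -/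
@[simp] theorem boxVec_zero (v : Fin Kx × Fin Ky) : boxVec a b v 0 = (v.1 : ℤ) * a := rfl

omit [NeZero a] [NeZero b] in
/-- Components of `boxVec`. [cite: FriedliVelenik2017, §3.1] -/
@[simp] theorem boxVec_one (v : Fin Kx × Fin Ky) : boxVec a b v 1 = (v.2 : ℤ) * b := rfl

include hLx hLy

omit [NeZero a] [NeZero b] [NeZero L] in
/-- **The box lattice acts on the box indices**: `z(v + w) ≡ z(v) + z(w) (mod L)` for the componentwise addition of
`Fin K_x × Fin K_y`. [cite: FriedliVelenik2017, §3.1] -/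
theorem dvd_boxVec_add_sub (v w : Fin Kx × Fin Ky) (i : Fin 2) :
    (L : ℤ) ∣ boxVec a b (v + w) i - (boxVec a b v i + boxVec a b w i) := by
  fin_cases i
  · show (L : ℤ) ∣ boxVec a b (v + w) 0 - (boxVec a b v 0 + boxVec a b w 0)
    simp only [boxVec_zero, Prod.fst_add, Fin.val_add]
    rw [hLx]
    refine ⟨-(((v.1 : ℕ) + (w.1 : ℕ)) / Kx : ℕ), ?_⟩
    have h := Nat.div_add_mod ((v.1 : ℕ) + (w.1 : ℕ)) Kx
    have h' : (((((v.1 : ℕ) + (w.1 : ℕ)) % Kx : ℕ) : ℤ)) = ((v.1 : ℕ) : ℤ) + ((w.1 : ℕ) : ℤ) -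
        (Kx : ℤ) * ((((v.1 : ℕ) + (w.1 : ℕ)) / Kx : ℕ) : ℤ) := by
      have := congrArg (fun n : ℕ => (n : ℤ)) h
      push_cast at this ⊢
      linarith
    rw [h']
    ring
  · show (L : ℤ) ∣ boxVec a b (v + w) 1 - (boxVec a b v 1 + boxVec a b w 1)
    simp only [boxVec_one, Prod.snd_add, Fin.val_add]
    rw [hLy]
    refine ⟨-(((v.2 : ℕ) + (w.2 : ℕ)) / Ky : ℕ), ?_⟩
    have h := Nat.div_add_mod ((v.2 : ℕ) + (w.2 : ℕ)) Ky
    have h' : (((((v.2 : ℕ) + (w.2 : ℕ)) % Ky : ℕ) : ℤ)) = ((v.2 : ℕ) : ℤ) + ((w.2 : ℕ) : ℤ) -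
        (Ky : ℤ) * ((((v.2 : ℕ) + (w.2 : ℕ)) / Ky : ℕ) : ℤ) := by
      have := congrArg (fun n : ℕ => (n : ℤ)) h
      push_cast at this ⊢
      linarith
    rw [h']
    ring

omit [NeZero a] [NeZero b] in
/-- `proj z(v + w) = proj z(v) + proj z(w)`. [cite: FriedliVelenik2017, §3.1] -/
theorem proj_boxVec_add (v w : Fin Kx × Fin Ky) :
    Torus.proj L (boxVec a b (v + w)) = Torus.proj L (boxVec a b v) + Torus.proj L (boxVec a b w) := by
  rw [← proj_add]
  have h := (torusPt_eq_iff L).2 (dvd_boxVec_add_sub a b L hLx hLy v w)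
  have := congrArg FermionTorus.toTorusSite h
  rwa [toTorusSite_torusPt, toTorusSite_torusPt] at this

omit [NeZero a] [NeZero b] in
/-- **The fundamental injectivity**: `(y, v) ↦ (y + z(v)) mod L` is injective on `[0,a)×[0,b) × (Fin K_x × Fin K_y)`
(`L = K_x a = K_y b`). [cite: FriedliVelenik2017, §3.1] -/
theorem eq_of_torusPt_add_boxVec_eq {y y' : Site 2} (hy : y ∈ rectWindow a b) (hy' : y' ∈ rectWindow a b)
    {v v' : Fin Kx × Fin Ky} (h : torusPt L (y + boxVec a b v) = torusPt L (y' + boxVec a b v')) :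
    y = y' ∧ v = v' := by
  rw [torusPt_eq_iff] at h
  rw [mem_rectWindow_iff] at hy hy'
  have h0 : (L : ℤ) ∣ (y 0 + ((v.1 : ℕ) : ℤ) * a) - (y' 0 + ((v'.1 : ℕ) : ℤ) * a) := h 0
  have h1 : (L : ℤ) ∣ (y 1 + ((v.2 : ℕ) : ℤ) * b) - (y' 1 + ((v'.2 : ℕ) : ℤ) * b) := h 1
  rw [hLx] at h0
  rw [hLy] at h1
  -- coordinate 0: `K_x a ∣ (y₀ − y₀') + (v₁ − v₁') a` forces `y₀ = y₀'` (|y₀ − y₀'| < a) and then `K_x ∣ v₁ − v₁'`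
  have ha0 : (a : ℤ) ∣ y 0 - y' 0 := by
    obtain ⟨q, hq⟩ := h0
    exact ⟨Kx * q - ((v.1 : ℕ) : ℤ) + ((v'.1 : ℕ) : ℤ), by linarith⟩
  have hy0 : y 0 = y' 0 := by
    have : y 0 - y' 0 = 0 := Int.eq_zero_of_abs_lt_dvd ha0 (by rw [abs_sub_lt_iff]; constructor <;> linarith)
    linarith
  have hb1 : (b : ℤ) ∣ y 1 - y' 1 := by
    obtain ⟨q, hq⟩ := h1
    exact ⟨Ky * q - ((v.2 : ℕ) : ℤ) + ((v'.2 : ℕ) : ℤ), by linarith⟩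
  have hy1 : y 1 = y' 1 := by
    have : y 1 - y' 1 = 0 := Int.eq_zero_of_abs_lt_dvd hb1 (by rw [abs_sub_lt_iff]; constructor <;> linarith)
    linarith
  have ha : (0 : ℤ) < a := by linarith
  have hb : (0 : ℤ) < b := by linarith
  have hv1 : (Kx : ℤ) ∣ ((v.1 : ℕ) : ℤ) - ((v'.1 : ℕ) : ℤ) := by
    obtain ⟨q, hq⟩ := h0
    refine ⟨q, ?_⟩
    have : (((v.1 : ℕ) : ℤ) - ((v'.1 : ℕ) : ℤ)) * a = (Kx * q) * a := by nlinarith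
    exact mul_right_cancel₀ ha.ne' this
  have hv2 : (Ky : ℤ) ∣ ((v.2 : ℕ) : ℤ) - ((v'.2 : ℕ) : ℤ) := by
    obtain ⟨q, hq⟩ := h1
    refine ⟨q, ?_⟩
    have : (((v.2 : ℕ) : ℤ) - ((v'.2 : ℕ) : ℤ)) * b = (Ky * q) * b := by nlinarith
    exact mul_right_cancel₀ hb.ne' this
  have hv1' : (v.1 : ℕ) = v'.1 := by
    have hlt : |((v.1 : ℕ) : ℤ) - ((v'.1 : ℕ) : ℤ)| < Kx := by
      rw [abs_sub_lt_iff]; constructor <;> linarith [v.1.isLt, v'.1.isLt, show (0:ℤ) ≤ (v.1 : ℕ) from by positivity,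
        show ((v.1 : ℕ) : ℤ) < Kx from by exact_mod_cast v.1.isLt, show ((v'.1 : ℕ) : ℤ) < Kx from by exact_mod_cast v'.1.isLt,
        show (0:ℤ) ≤ (v'.1 : ℕ) from by positivity]
    have := Int.eq_zero_of_abs_lt_dvd hv1 hlt
    exact_mod_cast (sub_eq_zero.1 this)
  have hv2' : (v.2 : ℕ) = v'.2 := by
    have hlt : |((v.2 : ℕ) : ℤ) - ((v'.2 : ℕ) : ℤ)| < Ky := by
      rw [abs_sub_lt_iff]; constructor <;> linarith [show ((v.2 : ℕ) : ℤ) < Ky from by exact_mod_cast v.2.isLt,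
        show ((v'.2 : ℕ) : ℤ) < Ky from by exact_mod_cast v'.2.isLt, show (0:ℤ) ≤ (v.2 : ℕ) from by positivity,
        show (0:ℤ) ≤ (v'.2 : ℕ) from by positivity]
    have := Int.eq_zero_of_abs_lt_dvd hv2 hlt
    exact_mod_cast (sub_eq_zero.1 this)
  refine ⟨?_, Prod.ext (Fin.ext hv1') (Fin.ext hv2')⟩
  funext i
  fin_cases i
  · exact hy0
  · exact hy1

omit [NeZero a] [NeZero b] in
/-- **The leg of box `v` into the torus**: `y ↦ (y + z(v)) mod L` on `[0,a)×[0,b)`. [cite: ArakiMoriya2003, §4.1 Def. 4.3] -/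
def boxLeg (v : Fin Kx × Fin Ky) : PolySite (rectWindow a b) ↪ FermionTorus 2 L :=
  ⟨fun y => torusPt L (ofLex y.1 + boxVec a b v), fun y y' h =>
    Subtype.ext (congrArg toLex (eq_of_torusPt_add_boxVec_eq a b L hLx hLy (PolySite.ofLex_mem y)
      (PolySite.ofLex_mem y') h).1)⟩

omit [NeZero a] [NeZero b] in
/-- The box leg on an ordered site. [cite: FriedliVelenik2017, §3.1] -/
@[simp] theorem boxLeg_apply (v : Fin Kx × Fin Ky) (y : PolySite (rectWindow a b)) :
    boxLeg a b L hLx hLy v y = torusPt L (ofLex y.1 + boxVec a b v) := rfl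

omit [NeZero a] [NeZero b] in
/-- **Distinct boxes have disjoint images in the torus.** [cite: FriedliVelenik2017, §3.1] -/
theorem disjoint_boxLeg : ∀ v v' : Fin Kx × Fin Ky, v ≠ v' →
    Disjoint ((Finset.univ : Finset (PolySite (rectWindow a b))).map (boxLeg a b L hLx hLy v))
      ((Finset.univ : Finset (PolySite (rectWindow a b))).map (boxLeg a b L hLx hLy v')) := by
  intro v v' hvv'
  rw [Finset.disjoint_left]
  rintro x hx hx'
  obtain ⟨y, -, rfl⟩ := Finset.mem_map.1 hx
  obtain ⟨y', -, hyy'⟩ := Finset.mem_map.1 hx'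
  exact hvv' (eq_of_torusPt_add_boxVec_eq a b L hLx hLy (PolySite.ofLex_mem y') (PolySite.ofLex_mem y) hyy').2.symm

omit [NeZero a] [NeZero b] hLx hLy in
/-- `|[0,a)×[0,b)| = ab`. [cite: FriedliVelenik2017, §3.1] -/
theorem card_rectWindow : (rectWindow a b).card = a * b := by
  have h : rectWindow a b = (Finset.range a ×ˢ Finset.range b).image fun p : ℕ × ℕ => mkSite2 p.1 p.2 := by
    ext x
    rw [mem_rectWindow_iff, Finset.mem_image]
    constructor
    · rintro ⟨⟨h0, h0'⟩, h1, h1'⟩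
      refine ⟨((x 0).toNat, (x 1).toNat), Finset.mem_product.2 ⟨Finset.mem_range.2 ?_, Finset.mem_range.2 ?_⟩, ?_⟩
      · have := Int.toNat_of_nonneg h0; omega
      · have := Int.toNat_of_nonneg h1; omega
      · funext i
        fin_cases i
        · show ((x 0).toNat : ℤ) = x 0; exact Int.toNat_of_nonneg h0
        · show ((x 1).toNat : ℤ) = x 1; exact Int.toNat_of_nonneg h1
    · rintro ⟨p, hp, rfl⟩
      obtain ⟨hp1, hp2⟩ := Finset.mem_product.1 hp
      rw [Finset.mem_range] at hp1 hp2
      refine ⟨⟨?_, ?_⟩, ?_, ?_⟩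
      · show (0 : ℤ) ≤ (p.1 : ℤ); positivity
      · show (p.1 : ℤ) < a; exact_mod_cast hp1
      · show (0 : ℤ) ≤ (p.2 : ℤ); positivity
      · show (p.2 : ℤ) < b; exact_mod_cast hp2
  rw [h, Finset.card_image_of_injective, Finset.card_product, Finset.card_range, Finset.card_range]
  intro p q hpq
  have h0 : (p.1 : ℤ) = q.1 := congrFun hpq 0
  have h1 : (p.2 : ℤ) = q.2 := congrFun hpq 1
  exact Prod.ext (by exact_mod_cast h0) (by exact_mod_cast h1)

omit [NeZero a] [NeZero b] [NeZero L] in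
/-- **The boxes tile the torus (counting)**: `Σ_v |[0,a)×[0,b)| = |(ℤ/Lℤ)²|`. [cite: FriedliVelenik2017, §3.1] -/
theorem sum_card_box_eq_card_torus :
    ∑ _v : Fin Kx × Fin Ky, Fintype.card (PolySite (rectWindow a b)) = Fintype.card (FermionTorus 2 L) := by
  rw [Finset.sum_const, Finset.card_univ, Fintype.card_prod, Fintype.card_fin, Fintype.card_fin, card_polySite,
    card_rectWindow, smul_eq_mul]
  have hcard : Fintype.card (FermionTorus 2 L) = L * L := by simp [FermionTorus, Fintype.card_lex, sq]
  rw [hcard]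
  have h : ((Kx * Ky * (a * b) : ℕ) : ℤ) = L * L := by
    have e : (L : ℤ) * L = (Kx * a) * (Ky * b) := by rw [← hLx, ← hLy]
    rw [e]; push_cast; ring
  exact_mod_cast h

omit [NeZero a] [NeZero b] in
/-- **The boxes tile the torus (bijection)**: `(y, v) ↦ (y + z(v)) mod L` is a bijection
`[0,a)×[0,b) × (Fin K_x × Fin K_y) ≃ (ℤ/Lℤ)²`. [cite: FriedliVelenik2017, §3.1] -/
theorem bijective_boxSite :
    Function.Bijective fun p : PolySite (rectWindow a b) × (Fin Kx × Fin Ky) => boxLeg a b L hLx hLy p.2 p.1 := by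
  rw [Fintype.bijective_iff_injective_and_card]
  refine ⟨fun p q hpq => ?_, ?_⟩
  · have h := eq_of_torusPt_add_boxVec_eq a b L hLx hLy (PolySite.ofLex_mem p.1) (PolySite.ofLex_mem q.1) hpq
    exact Prod.ext (Subtype.ext (congrArg toLex h.1)) h.2
  · rw [Fintype.card_prod, ← sum_card_box_eq_card_torus a b L hLx hLy, Finset.sum_const, Finset.card_univ, smul_eq_mul,
      mul_comm]

omit [NeZero a] [NeZero b] in
/-- **Site sums over the torus decompose over the boxes**: `Σ_{w ∈ (ℤ/Lℤ)²} f(w) = Σ_v Σ_{y ∈ box} f((y + z(v)) mod L)`.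
[cite: FriedliVelenik2017, §3.1] -/
theorem sum_torusSite_eq_sum_boxes {M : Type*} [AddCommMonoid M] (f : TorusSite 2 L → M) :
    ∑ w : TorusSite 2 L, f w =
      ∑ v : Fin Kx × Fin Ky, ∑ y : PolySite (rectWindow a b), f (Torus.proj L (ofLex y.1 + boxVec a b v)) := by
  have h1 : ∑ w : TorusSite 2 L, f w = ∑ x : FermionTorus 2 L, f (FermionTorus.toTorusSite x) :=
    (Fintype.sum_equiv FermionTorus.equivTorusSite (fun x => f (FermionTorus.toTorusSite x)) f fun _ => rfl).symm
  have h2 : ∑ x : FermionTorus 2 L, f (FermionTorus.toTorusSite x) =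
      ∑ p : PolySite (rectWindow a b) × (Fin Kx × Fin Ky), f (FermionTorus.toTorusSite (boxLeg a b L hLx hLy p.2 p.1)) :=
    (Fintype.sum_equiv (Equiv.ofBijective _ (bijective_boxSite a b L hLx hLy))
      (fun p => f (FermionTorus.toTorusSite (boxLeg a b L hLx hLy p.2 p.1))) (fun x => f (FermionTorus.toTorusSite x))
      fun _ => rfl).symm
  rw [h1, h2, Fintype.sum_prod_type, Finset.sum_comm]
  refine Finset.sum_congr rfl fun v _ => Finset.sum_congr rfl fun y _ => ?_
  rw [boxLeg_apply, toTorusSite_torusPt]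

variable {m : ℕ} (G : Fin m → Finset (Site 2)) (hG : ∀ g, G g ⊆ gateRange a b) (hK : 3 ≤ Kx ∧ 3 ≤ Ky)
include hG hK

omit [NeZero a] [NeZero b] in
/-- Two sites of a reference gate with the same torus image after the same box translation coincide
(`diam G g < 3a ≤ L`). [cite: FriedliVelenik2017, §3.1] -/
theorem eq_of_torusPt_gate_eq {g : Fin m} {y y' : Site 2} (hy : y ∈ G g) (hy' : y' ∈ G g) {c : Site 2}
    (h : torusPt L (y + c) = torusPt L (y' + c)) : y = y' := by
  have hlt := abs_sub_lt_of_mem_gateRange a b (hG g hy) (hG g hy')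
  have hLa : (3 : ℤ) * a ≤ L := by
    rw [hLx]; have : (3 : ℤ) ≤ Kx := by exact_mod_cast hK.1
    have : (0 : ℤ) ≤ a := by positivity
    nlinarith
  have hLb : (3 : ℤ) * b ≤ L := by
    rw [hLy]; have : (3 : ℤ) ≤ Ky := by exact_mod_cast hK.2
    have : (0 : ℤ) ≤ b := by positivity
    nlinarith
  have h' := eq_of_torusPt_eq L h (fun i => by
    fin_cases i
    · show |(y + c) 0 - (y' + c) 0| < L
      simp only [Pi.add_apply, add_sub_add_right_eq_sub]; linarith [hlt.1]
    · show |(y + c) 1 - (y' + c) 1| < L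
      simp only [Pi.add_apply, add_sub_add_right_eq_sub]; linarith [hlt.2])
  exact add_right_cancel h'

omit [NeZero a] [NeZero b] in
/-- **The leg of the gate `(g, v)`** (reference gate `g` translated to box `v`) into the torus: `y ↦ (y + z(v)) mod L` on
`G g`. [cite: ArakiMoriya2003, §4.1 Def. 4.3] -/
def gateLegT (k : Fin m × (Fin Kx × Fin Ky)) : PolySite (G k.1) ↪ FermionTorus 2 L :=
  ⟨fun y => torusPt L (ofLex y.1 + boxVec a b k.2), fun y y' h =>
    Subtype.ext (congrArg toLex (eq_of_torusPt_gate_eq a b L hLx hLy G hG hK (PolySite.ofLex_mem y)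
      (PolySite.ofLex_mem y') h))⟩

omit [NeZero a] [NeZero b] in
/-- The gate leg on an ordered site. [cite: FriedliVelenik2017, §3.1] -/
@[simp] theorem gateLegT_apply (k : Fin m × (Fin Kx × Fin Ky)) (y : PolySite (G k.1)) :
    gateLegT a b L hLx hLy G hG hK k y = torusPt L (ofLex y.1 + boxVec a b k.2) := rfl

/-- **Separated gates have pairwise disjoint images in the torus** (all `K_x K_y m` of them).
[cite: BratteliRobinsonII1997, §5.2.2] -/
theorem disjoint_gateLegT
    (hsep : ∀ g g', ∀ x ∈ G g, ∀ x' ∈ G g', ((a : ℤ) ∣ x' 0 - x 0) → ((b : ℤ) ∣ x' 1 - x 1) → g = g' ∧ x = x') : ∀ k k' : Fin m × (Fin Kx × Fin Ky), k ≠ k' →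
    Disjoint ((Finset.univ : Finset (PolySite (G k.1))).map (gateLegT a b L hLx hLy G hG hK k))
      ((Finset.univ : Finset (PolySite (G k'.1))).map (gateLegT a b L hLx hLy G hG hK k')) := by
  intro k k' hkk'
  rw [Finset.disjoint_left]
  rintro x hx hx'
  obtain ⟨y, -, rfl⟩ := Finset.mem_map.1 hx
  obtain ⟨y', -, hyy'⟩ := Finset.mem_map.1 hx'
  rw [gateLegT_apply, gateLegT_apply, torusPt_eq_iff] at hyy'
  have h0 : (L : ℤ) ∣ (ofLex y'.1 0 + ((k'.2.1 : ℕ) : ℤ) * a) - (ofLex y.1 0 + ((k.2.1 : ℕ) : ℤ) * a) := hyy' 0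
  have h1 : (L : ℤ) ∣ (ofLex y'.1 1 + ((k'.2.2 : ℕ) : ℤ) * b) - (ofLex y.1 1 + ((k.2.2 : ℕ) : ℤ) * b) := hyy' 1
  rw [hLx] at h0
  rw [hLy] at h1
  -- congruence modulo the box lattice
  have ha : (a : ℤ) ∣ ofLex y.1 0 - ofLex y'.1 0 := by
    obtain ⟨q, hq⟩ := h0
    exact ⟨((k'.2.1 : ℕ) : ℤ) - ((k.2.1 : ℕ) : ℤ) - Kx * q, by linarith⟩
  have hb : (b : ℤ) ∣ ofLex y.1 1 - ofLex y'.1 1 := by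
    obtain ⟨q, hq⟩ := h1
    exact ⟨((k'.2.2 : ℕ) : ℤ) - ((k.2.2 : ℕ) : ℤ) - Ky * q, by linarith⟩
  obtain ⟨hgg, hyy⟩ := hsep k'.1 k.1 (ofLex y'.1) (PolySite.ofLex_mem y') (ofLex y.1) (PolySite.ofLex_mem y) ha hb
  -- then the box translations agree modulo `L`, hence the box indices agree
  have hv : k'.2 = k.2 := by
    have key : torusPt L ((0 : Site 2) + boxVec a b k'.2) = torusPt L ((0 : Site 2) + boxVec a b k.2) := by
      rw [torusPt_eq_iff]
      intro i
      have := hyy' i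
      fin_cases i
      · show (L : ℤ) ∣ ((0 : ℤ) + ((k'.2.1 : ℕ) : ℤ) * a) - ((0 : ℤ) + ((k.2.1 : ℕ) : ℤ) * a)
        have e : ofLex y'.1 0 = ofLex y.1 0 := by rw [hyy]
        rw [hLx]
        obtain ⟨q, hq⟩ := h0
        exact ⟨q, by rw [e] at hq; linarith⟩
      · show (L : ℤ) ∣ ((0 : ℤ) + ((k'.2.2 : ℕ) : ℤ) * b) - ((0 : ℤ) + ((k.2.2 : ℕ) : ℤ) * b)
        have e : ofLex y'.1 1 = ofLex y.1 1 := by rw [hyy]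
        rw [hLy]
        obtain ⟨q, hq⟩ := h1
        exact ⟨q, by rw [e] at hq; linarith⟩
    have h0mem : (0 : Site 2) ∈ rectWindow a b := by
      rw [mem_rectWindow_iff]
      have : 0 < a := Nat.pos_of_ne_zero (NeZero.ne a)
      have : 0 < b := Nat.pos_of_ne_zero (NeZero.ne b)
      simp only [Pi.zero_apply]
      exact ⟨⟨le_rfl, by exact_mod_cast ‹0 < a›⟩, le_rfl, by exact_mod_cast ‹0 < b›⟩
    exact (eq_of_torusPt_add_boxVec_eq a b L hLx hLy h0mem h0mem key).2
  apply hkk'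
  exact Prod.ext hgg.symm hv.symm

end Legs

/-! ### §4. Box translations of the torus act on the legs -/

section Translate

variable {d L : ℕ} [NeZero L] {Ω : Type*} [LinearOrder Ω] [Fintype Ω]

/-- (Local to this file, as in `HubbardTorusTTPrimeClusterEnergyRepresentative.lean`.) Equality of torus sites is
decided through the linear order — the instance the generic Jordan–Wigner lemmas carry; without it the two coexisting
`DecidableEq (FermionTorus d L)` paths make `relabel` on the torus time out. [folklore] -/
local instance (priority := high) instDecidableEqFermionTorusSeamDressed : DecidableEq (FermionTorus d L) :=
  LinearOrder.toDecidableEq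

/-- **Translation covariance of placed observables**: if two legs differ by the torus translation `c`
(`ψ' y = ψ y + c`), then `T_c Γ_ψ A = Γ_{ψ'} A` with `T_c = relabel (Orb.translate c)`.
[cite: ArakiMoriya2003, §4.1 Def. 4.3] -/
theorem relabel_translate_fermionEmbed_of_shift (ψ ψ' : Ω ↪ FermionTorus d L) (c : TorusSite d L)
    (h : ∀ y, FermionTorus.toTorusSite (ψ' y) = FermionTorus.toTorusSite (ψ y) + c)
    (A : Matrix (Finset (Orb Ω)) (Finset (Orb Ω)) ℂ) :
    relabel (Orb.translate c) (fermionEmbed ψ A) = fermionEmbed ψ' A := by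
  have h' : ∀ y, FermionTorus.ofTorusSite (FermionTorus.toTorusSite (ψ y) + c) = ψ' y := fun y => by
    rw [← h y, FermionTorus.ofTorusSite_toTorusSite]
  have key : ((relabel (Orb.translate c) :
      Matrix (Finset (Orb (FermionTorus d L))) (Finset (Orb (FermionTorus d L))) ℂ ≃ₐ[ℂ]
        Matrix (Finset (Orb (FermionTorus d L))) (Finset (Orb (FermionTorus d L))) ℂ).toAlgHom).comp (fermionEmbed ψ) =
      fermionEmbed ψ' := by
    refine algHom_ext_car (fun i => ?_) (fun i => ?_)
    · rw [AlgHom.comp_apply, fermionEmbed_annihilation', fermionEmbed_annihilation']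
      show relabel (Orb.translate c) (annihilation (orb (ψ (ofLex i).1) (ofLex i).2)) = _
      rw [relabel_annihilation, Orb.translate_apply]
      show annihilation (orb (FermionTorus.ofTorusSite (FermionTorus.toTorusSite (ψ (ofLex i).1) + c)) (ofLex i).2) = _
      rw [h']
    · rw [AlgHom.comp_apply, fermionEmbed_creation', fermionEmbed_creation']
      show relabel (Orb.translate c) (creation (orb (ψ (ofLex i).1) (ofLex i).2)) = _
      rw [relabel_creation, Orb.translate_apply]
      show creation (orb (FermionTorus.ofTorusSite (FermionTorus.toTorusSite (ψ (ofLex i).1) + c)) (ofLex i).2) = _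
      rw [h']
  have := AlgHom.congr_fun key A
  rwa [AlgHom.comp_apply] at this

variable (a b : ℕ) [NeZero a] [NeZero b] (L' : ℕ) [NeZero L'] {Kx Ky : ℕ}
  (hLx : (L' : ℤ) = Kx * a) (hLy : (L' : ℤ) = Ky * b)
include hLx hLy

omit [NeZero a] [NeZero b] in
/-- **Box translations permute the boxes**: `T_{z(w)} Γ_{box v} A = Γ_{box (v+w)} A`. [cite: ArakiMoriya2003, §4.1 Def. 4.3] -/
theorem relabel_translate_boxLeg (v w : Fin Kx × Fin Ky)
    (A : Matrix (Finset (Orb (PolySite (rectWindow a b)))) (Finset (Orb (PolySite (rectWindow a b)))) ℂ) :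
    relabel (Orb.translate (Torus.proj L' (boxVec a b w))) (fermionEmbed (boxLeg a b L' hLx hLy v) A) =
      fermionEmbed (boxLeg a b L' hLx hLy (v + w)) A := by
  refine relabel_translate_fermionEmbed_of_shift _ _ _ (fun y => ?_) A
  rw [boxLeg_apply, boxLeg_apply, toTorusSite_torusPt, toTorusSite_torusPt, proj_add, proj_add,
    proj_boxVec_add a b L' hLx hLy, add_assoc]

variable {m : ℕ} (G : Fin m → Finset (Site 2)) (hG : ∀ g, G g ⊆ gateRange a b) (hK : 3 ≤ Kx ∧ 3 ≤ Ky)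
include hG hK

omit [NeZero a] [NeZero b] in
/-- **Box translations permute the gates**: `T_{z(w)} Γ_{gate (g,v)} A = Γ_{gate (g, v+w)} A`.
[cite: ArakiMoriya2003, §4.1 Def. 4.3] -/
theorem relabel_translate_gateLegT (g : Fin m) (v w : Fin Kx × Fin Ky)
    (A : Matrix (Finset (Orb (PolySite (G g)))) (Finset (Orb (PolySite (G g)))) ℂ) :
    relabel (Orb.translate (Torus.proj L' (boxVec a b w))) (fermionEmbed (gateLegT a b L' hLx hLy G hG hK (g, v)) A) =
      fermionEmbed (gateLegT a b L' hLx hLy G hG hK (g, v + w)) A := by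
  refine relabel_translate_fermionEmbed_of_shift _ _ _ (fun y => ?_) A
  rw [gateLegT_apply, gateLegT_apply, toTorusSite_torusPt, toTorusSite_torusPt, proj_add, proj_add]
  show Torus.proj L' (ofLex y.1) + Torus.proj L' (boxVec a b (v + w)) = _
  rw [proj_boxVec_add a b L' hLx hLy, add_assoc]

end Translate

end SeamDressed

end Literature.MathematicalPhysics.QuantumLattice

end
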